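import Literature.NumberTheory.EllipticCurves.PAdicLFunctionIntegralityAtTwoAutoProofs
import Literature.NumberTheory.EllipticCurves.PAdicLFunctionMuInvariantCertificateProofs
import HarnessLib

/-!
# Route `ByReductionTypeAtTwo` (K4), TOWER road / shared μ₂-supply target — the COLLAPSE AT `p = 2`:
# a half-integral winding class `[b/2ᵏ]⁺_f − [0]⁺_f ∈ ½ + ℤ` forces a UNIT value `2·μ_{f,α}(b + 2ᵐℤ₂)` of
# the doubled Mazur–Swinnerton-Dyer measure at an odd class (ordinary `2`, odd level, odd Eisenstein multiple)

Cell `bsd-2adic`, seat `bsd-2adic-tower-1` (GEN 24), `--supports stmt-BirchSwinnertonDyer-19271` (helper; brick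
P3 of the kernel road «analytic `μ = 0` at `2` on {good ordinary at `2`, `E[2]` irreducible}» — planner RC-250
stub S3 «dictionary D2 / CollapseAtTwo», measure half).  Theorems only; no definition, no named fact, no `sorry`.

## Statement (`exists_odd_norm_two_mul_msdMeasure_eq_one`)

`f` a normalised rational newform on `Γ₀(N)`, `N` odd, `a₂ = a₂(f)` ODD (ordinary), `α ∈ ℚ₂` a root of
`X² − a₂X + 2` with `‖α‖₂ = 1`, and an ODD Eisenstein multiple `n₀{∞,0}_f ∈ Λ_f` (supplied by `E[2]`
irreducible: `exists_intCast_mul_modularSymbol_zero_mem`).  IF some 2-power cusp has a half-integral winding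
class, `1 ≤ ‖2([b/2ᵏ]⁺_f − [0]⁺_f)‖₂` (the output of the Stevens bridge at `2`,
`ByReductionTypeAtTwoAnalyticMuStevensBridge`), THEN for some `m ≥ 2` and some ODD class `b mod 2ᵐ`

  `‖2·μ_{f,α}(b + 2ᵐℤ₂)‖₂ = 1`,   `μ_{f,α}(b + 2ᵐℤ₂) = α⁻ᵐ[b/2ᵐ]⁺ − α⁻ᵐ⁻¹[b/2ᵐ⁻¹]⁺` (`msdMeasure`).

## Proof (the `p = 2` collapse; o1 lens-1 «INT2-AUTO» bookkeeping run backwards)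

Write `D(k,b) := 2([b/2ᵏ]⁺ − [0]⁺) ∈ ℤ` (Manin: cusps with denominator prime to `N`,
`exists_ratPlusSymbol_eq_add_div_two`), `S₀ := 2[0]⁺` — `2`-INTEGRAL because the Eisenstein multiple is odd
(`exists_ratPlusSymbol_eq_div_two`: `[0]⁺ = k/(2n₀)`) — and `ε := (α − 1)S₀`, `‖ε‖₂ ≤ ½` (`α ≡ 1 (mod 2)`:
`α(α − a₂) = −2`, `a₂` odd).  Then `2μ(b + 2ᵏ⁺¹ℤ₂) = α⁻ᵏ⁻²·[(D(k+1,b) − D(k,b)) + (α−1)D(k+1,b) + ε]`.  Suppose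
every `2μ` at an odd class of level `≥ 2` were NON-unit (norm `≤ ½`).  Then `D(k+1,b) ≡ D(k,b) (mod 2)` for
odd `b` and `k ≥ 1`; at level `1`, the Hecke relation at the cusp `0` (`[1/2]⁺ = (a₂ − 2)[0]⁺`,
`normalizedPlusSymbol_half_eq`) gives `D(1,b) = (a₂ − 3)S₀ ≡ 0`; even `b` reduce the level; `D(0,b) = 0`.
By induction EVERY `D(k,b) ≡ 0 (mod 2)` — contradicting the half-integral winding class.  (The role of the
odd Eisenstein multiple: without it `ε` may be a unit — o1's census has `v₂(ε_f) = 0` on 6/618 optimal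
ordinary `f`, all with rational `2`-torsion — and the induction only yields `D(k,b) ≡ k·ε`.)

HONEST FRAMING: nothing about any curve is asserted; elementary and presumably folklore (no printed statement
at `p = 2` in this normalisation known to the cell: presearch corpus fts/hybrid/vsearch + galaxy, 0 hits);
beyond-print: no.  BSD is not proved by any of this.

References: [MazurTateTeitelbaum1986Invent] §I.4 (4.2), §I.8, §I.10 (10.1); [CremonaAlgorithms1997] §2.8;
[Stevens1989] §4; [GreenbergVatsal2000] Prop. (3.7).
-/

-- the summit namespace repeats `BirchSwinnertonDyer` by design (summit = problem); linter moot
set_option linter.dupNamespace false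
set_option autoImplicit false

noncomputable section

namespace Summit.BirchSwinnertonDyer.BirchSwinnertonDyer.Theorems.AnalyticMuTwo

open scoped MatrixGroups ModularForm

open CongruenceSubgroup Literature.NumberTheory.EllipticCurves Literature.NumberTheory.EllipticCurves.ModularForms

section Norms

/-- An even integer has `2`-adic norm `≤ ½` (`‖2w‖₂ = ½‖w‖₂`). [cite: Koblitz1984, Ch. I §2 (p. 2: |x|_p = p^(-ord_p x))] -/
theorem norm_intCast_le_half_of_two_dvd {z : ℤ} (h : (2 : ℤ) ∣ z) : ‖((z : ℤ) : ℚ_[2])‖ ≤ 2⁻¹ := by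
  obtain ⟨w, rfl⟩ := h
  have h2 : ‖(2 : ℚ_[2])‖ = 2⁻¹ := by simpa using Padic.norm_p (p := 2)
  push_cast
  rw [norm_mul, h2]
  calc (2 : ℝ)⁻¹ * ‖((w : ℤ) : ℚ_[2])‖ ≤ 2⁻¹ * 1 := by gcongr; exact Padic.norm_int_le_one w
    _ = 2⁻¹ := mul_one _

end Norms

section Symbols

variable {N : ℕ} [NeZero N] {f : CuspForm (Gamma0 N) 2}

/-- **`D(k,b) = 2([b/2ᵏ]⁺_f − [0]⁺_f)` is an INTEGER** for a real-coefficient `f` of odd level (the cusp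
`b/2ᵏ` has denominator prime to `N`; Manin, `exists_ratPlusSymbol_eq_add_div_two`).
[cite: MazurTateTeitelbaum1986Invent, §I.8] [cite: CremonaAlgorithms1997, §2.8] -/
theorem exists_two_mul_ratPlusSymbol_sub_eq_intCast (hreal : ∀ n, (cuspCoeff f n).im = 0)
    (h2N : ¬ 2 ∣ N) (k : ℕ) (b : ℤ) :
    ∃ z : ℤ, 2 * (ratPlusSymbol f ((b : ℚ) / (2 : ℚ) ^ k) - ratPlusSymbol f 0) = z := by
  have hcop : Nat.Coprime (2 ^ k) N :=
    Nat.Coprime.pow_left k ((Nat.Prime.coprime_iff_not_dvd Nat.prime_two).mpr h2N)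
  have hx : Nat.Coprime (((b : ℚ) / (2 : ℚ) ^ k)).den N := by
    have h := coprime_den_of_coprime hcop b
    push_cast at h
    exact h
  obtain ⟨z, hz⟩ := exists_ratPlusSymbol_eq_add_div_two f hreal hx
  exact ⟨z, by rw [hz]; ring⟩

/-- Norm form: `‖2([b/2ᵏ]⁺_f − [0]⁺_f)‖₂ ≤ 1`. [cite: MazurTateTeitelbaum1986Invent, §I.8] -/
theorem norm_two_mul_ratPlusSymbol_sub_le_one (hreal : ∀ n, (cuspCoeff f n).im = 0)
    (h2N : ¬ 2 ∣ N) (k : ℕ) (b : ℤ) :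
    ‖(((2 : ℚ) * (ratPlusSymbol f ((b : ℚ) / (2 : ℚ) ^ k) - ratPlusSymbol f 0) : ℚ) : ℚ_[2])‖ ≤ 1 := by
  obtain ⟨z, hz⟩ := exists_two_mul_ratPlusSymbol_sub_eq_intCast hreal h2N k b
  rw [hz, Rat.cast_intCast]
  exact Padic.norm_int_le_one z

/-- **`S₀ = 2[0]⁺_f` is `2`-INTEGRAL when an ODD Eisenstein multiple `n₀{∞,0}_f` lies in `Λ_f`**
(`[0]⁺ = k/(2n₀)`, `exists_ratPlusSymbol_eq_div_two`). [cite: CremonaAlgorithms1997, §2.8]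
[cite: GreenbergVatsal2000, Prop. (3.7)] -/
theorem norm_two_mul_ratPlusSymbol_zero_le_one (hreal : ∀ n, (cuspCoeff f n).im = 0) {n₀ : ℤ}
    (hn₀ : ¬ (2 : ℤ) ∣ n₀) (h0 : (n₀ : ℂ) * modularSymbol f 0 ∈ periodLattice f) :
    ‖(((2 : ℚ) * ratPlusSymbol f 0 : ℚ) : ℚ_[2])‖ ≤ 1 := by
  have hn₀0 : n₀ ≠ 0 := by rintro rfl; exact hn₀ (dvd_zero _)
  have hx : Nat.Coprime (0 : ℚ).den N := by simp
  obtain ⟨k, hk⟩ := exists_ratPlusSymbol_eq_div_two f hreal hn₀0 h0 hx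
  have hn : ‖((n₀ : ℤ) : ℚ_[2])‖ = 1 :=
    le_antisymm (Padic.norm_int_le_one n₀)
      (not_lt.mp fun hlt ↦ hn₀ (by exact_mod_cast Padic.norm_intCast_lt_one_iff.mp hlt))
  have hn0' : ((n₀ : ℤ) : ℚ_[2]) ≠ 0 := by
    intro h; rw [h, norm_zero] at hn; exact zero_ne_one hn
  have e : (((2 : ℚ) * ratPlusSymbol f 0 : ℚ) : ℚ_[2]) = ((k : ℤ) : ℚ_[2]) / ((n₀ : ℤ) : ℚ_[2]) := by
    rw [hk]; push_cast; field_simp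
  rw [e, norm_div, hn, div_one]
  exact Padic.norm_int_le_one k

/-- **Level one: `D(1,b) = (a₂ − 3)·S₀` for odd `b`** (`[b/2]⁺ = [1/2]⁺` by periodicity, then the Hecke
relation at `0`). [cite: MazurTateTeitelbaum1986Invent, §I.4 (4.2)] -/
theorem two_mul_ratPlusSymbol_sub_one_eq (hf : IsNewform0 f) (hQ : coeffField f = ⊥) (h2N : ¬ 2 ∣ N)
    {a₂ : ℤ} (ha₂ : cuspCoeff f 2 = a₂) {b : ℤ} (hb : Odd b) :
    2 * (ratPlusSymbol f ((b : ℚ) / (2 : ℚ) ^ 1) - ratPlusSymbol f 0) =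
      ((a₂ : ℚ) - 3) * (2 * ratPlusSymbol f 0) := by
  -- the Hecke relation at the cusp `0`, rational form: `[1/2]⁺ = (a₂ − 2)[0]⁺` (tree:
  -- `normalizedPlusSymbol_half_eq`; rational spelling also in `FlatParityAtTwo.ratPlusSymbol_half_eq`)
  have hhalf : ratPlusSymbol f (1 / 2) = ((a₂ : ℚ) - 2) * ratPlusSymbol f 0 := by
    have hrat : ∀ r : ℚ, (ratPlusSymbol f r : ℝ) = normalizedPlusSymbol f r :=
      fun r ↦ ratCast_ratPlusSymbol_holds hf hQ r
    have h := normalizedPlusSymbol_half_eq hf h2N ha₂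
    rw [← hrat, ← hrat] at h
    exact_mod_cast h
  obtain ⟨t, rfl⟩ := hb
  have e : (((2 * t + 1 : ℤ) : ℚ) / (2 : ℚ) ^ 1) = 1 / 2 + (t : ℤ) := by push_cast; ring
  rw [e, ratPlusSymbol_add_intCast_eq, hhalf]
  ring

end Symbols

section Collapse

variable {N : ℕ} [NeZero N] {f : CuspForm (Gamma0 N) 2}

/-- **THE COLLAPSE AT `2`.**  `f` a rational normalised newform of ODD level, `a₂(f)` ODD, `α` a UNIT root of
`X² − a₂X + 2` in `ℚ₂`, an ODD Eisenstein multiple `n₀{∞,0}_f ∈ Λ_f`; if some 2-power cusp `b/2ᵏ` has a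
half-integral winding class (`1 ≤ ‖2([b/2ᵏ]⁺ − [0]⁺)‖₂`), then some ODD class `b̄ mod 2^{n+2}` has
`‖2·μ_{f,α}(b̄ + 2^{n+2}ℤ₂)‖₂ = 1`.  Proof in the module docstring (induction on the level against the
hypothesis that all doubled measure values at odd classes of level `≥ 2` are even; `[1/2]⁺ = (a₂−2)[0]⁺`
starts it, the odd Eisenstein multiple makes `ε = 2(α−1)[0]⁺` even).
[cite: MazurTateTeitelbaum1986Invent, §I.10 (10.1)] [cite: MazurTateTeitelbaum1986Invent, §I.4 (4.2)] -/
theorem exists_odd_norm_two_mul_msdMeasure_eq_one (hf : IsNewform0 f) (hQ : coeffField f = ⊥)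
    (h2N : ¬ 2 ∣ N) {a₂ : ℤ} (ha₂ : cuspCoeff f 2 = a₂) (ha₂' : ¬ (2 : ℤ) ∣ a₂)
    {α : ℚ_[2]} (hα : ‖α‖ = 1) (hroot : α ^ 2 - a₂ * α + 2 = 0)
    {n₀ : ℤ} (hn₀ : ¬ (2 : ℤ) ∣ n₀) (h0 : (n₀ : ℂ) * modularSymbol f 0 ∈ periodLattice f)
    (hw : ∃ (k : ℕ) (b : ℤ), 1 ≤ ‖(((2 : ℚ) * (ratPlusSymbol f ((b : ℚ) / (2 : ℚ) ^ k) -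
      ratPlusSymbol f 0) : ℚ) : ℚ_[2])‖) :
    ∃ (n : ℕ) (b : ZMod (2 ^ (n + 2))), ¬ 2 ∣ b.val ∧ ‖2 * msdMeasure f α (n + 2) b‖ = 1 := by
  have hreal : ∀ n, (cuspCoeff f n).im = 0 := cuspCoeff_im_eq_zero_of_coeffField_eq_bot hQ
  have hα0 : α ≠ 0 := by rintro rfl; norm_num at hroot
  have hαinv : ‖α⁻¹‖ ≤ 1 := by rw [norm_inv, hα, inv_one]
  have hαi : ∀ j : ℕ, ‖α⁻¹ ^ j‖ = 1 := fun j ↦ by rw [norm_pow, norm_inv, hα, inv_one, one_pow]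
  have h2norm : ‖(2 : ℚ_[2])‖ = 2⁻¹ := by simpa using Padic.norm_p (p := 2)
  -- every doubled measure value has norm `≤ 1` (INT2-AUTO, `norm_msdMeasure_two_le_two_auto`)
  have hμ2 : ∀ (m : ℕ) (a : ZMod (2 ^ m)), ‖2 * msdMeasure f α m a‖ ≤ 1 := by
    intro m a
    rw [norm_mul, h2norm]
    calc (2 : ℝ)⁻¹ * ‖msdMeasure f α m a‖ ≤ 2⁻¹ * 2 := by
          gcongr; exact norm_msdMeasure_two_le_two_auto hf hreal h2N ha₂ hαinv hroot m a
      _ = 1 := by norm_num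
  -- `‖α − 1‖ ≤ ½`: `α(α − a₂) = −2`, `‖α‖ = 1`, `a₂` odd
  have hα1 : ‖α - 1‖ ≤ 2⁻¹ := by
    have h1 : α * (α - (a₂ : ℚ_[2])) = -2 := by linear_combination hroot
    have h2 : ‖α - (a₂ : ℚ_[2])‖ = 2⁻¹ := by
      have h := congrArg (‖·‖) h1
      simp only [norm_mul, hα, one_mul, norm_neg, h2norm] at h
      exact h
    have h3 : ‖((a₂ : ℤ) : ℚ_[2]) - 1‖ ≤ 2⁻¹ := by
      have hdvd : (2 : ℤ) ∣ a₂ - 1 := by omega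
      have h := norm_intCast_le_half_of_two_dvd hdvd
      push_cast at h
      exact h
    calc ‖α - 1‖ = ‖(α - (a₂ : ℚ_[2])) + (((a₂ : ℤ) : ℚ_[2]) - 1)‖ := by ring_nf
      _ ≤ max ‖α - (a₂ : ℚ_[2])‖ ‖((a₂ : ℤ) : ℚ_[2]) - 1‖ := Padic.nonarchimedean _ _
      _ ≤ 2⁻¹ := max_le h2.le h3
  -- notation-free abbreviations: `D k b`, `S₀`
  set S₀ : ℚ_[2] := (((2 : ℚ) * ratPlusSymbol f 0 : ℚ) : ℚ_[2]) with hS₀_def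
  have hS₀ : ‖S₀‖ ≤ 1 := norm_two_mul_ratPlusSymbol_zero_le_one hreal hn₀ h0
  have hε : ‖(α - 1) * S₀‖ ≤ 2⁻¹ := by
    rw [norm_mul]
    calc ‖α - 1‖ * ‖S₀‖ ≤ 2⁻¹ * 1 := mul_le_mul hα1 hS₀ (norm_nonneg _) (by norm_num)
      _ = 2⁻¹ := mul_one _
  set D : ℕ → ℤ → ℚ_[2] := fun k b ↦
    (((2 : ℚ) * (ratPlusSymbol f ((b : ℚ) / (2 : ℚ) ^ k) - ratPlusSymbol f 0) : ℚ) : ℚ_[2]) with hD_def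
  have hD1 : ∀ k b, ‖D k b‖ ≤ 1 := fun k b ↦ norm_two_mul_ratPlusSymbol_sub_le_one hreal h2N k b
  -- the symbol at a 2-power cusp, in terms of `D` and `S₀`
  have hsym : ∀ (k : ℕ) (b : ℤ),
      2 * ((ratPlusSymbol f ((b : ℚ) / (2 : ℚ) ^ k) : ℚ) : ℚ_[2]) = D k b + S₀ := by
    intro k b
    simp only [hD_def, hS₀_def]
    push_cast
    ring
  -- periodicity: the symbol only depends on `b mod 2^k·ℤ`-translates
  have hper : ∀ (k : ℕ) (b t : ℤ),
      ratPlusSymbol f (((b + 2 ^ k * t : ℤ) : ℚ) / (2 : ℚ) ^ k) =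
        ratPlusSymbol f ((b : ℚ) / (2 : ℚ) ^ k) := by
    intro k b t
    have e : (((b + 2 ^ k * t : ℤ) : ℚ) / (2 : ℚ) ^ k) = (b : ℚ) / (2 : ℚ) ^ k + (t : ℤ) := by
      push_cast; field_simp
    rw [e, ratPlusSymbol_add_intCast_eq]
  -- suppose, for contradiction, that no odd class of level `≥ 2` has a unit doubled value
  by_contra H
  push Not at H
  have hH : ∀ (n : ℕ) (b : ZMod (2 ^ (n + 2))), ¬ 2 ∣ b.val →
      ‖2 * msdMeasure f α (n + 2) b‖ ≤ 2⁻¹ := by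
    intro n b hb
    refine not_lt.mp fun hlt ↦ H n b hb ?_
    exact norm_eq_one_of_inv_lt_of_le_one (p := 2) (by exact_mod_cast hlt) (hμ2 _ _)
  -- the doubled measure value at the class of an odd integer `b` of level `k' + 2`, via `D`
  have hstep : ∀ (k' : ℕ) (b : ℤ), Odd b →
      ‖D (k' + 2) b - D (k' + 1) b‖ ≤ 2⁻¹ := by
    intro k' b hb
    haveI : NeZero (2 ^ (k' + 2)) := ⟨pow_ne_zero _ two_ne_zero⟩
    set bb : ZMod (2 ^ (k' + 2)) := (b : ZMod (2 ^ (k' + 2))) with hbb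
    -- `bb.val = b mod 2^(k'+2)`, an odd natural number
    have hval : ((bb.val : ℕ) : ℤ) = b % (2 ^ (k' + 2) : ℕ) := by
      rw [hbb, ZMod.val_intCast]
    -- `bb.val = b + 2^(k'+2)·q`
    obtain ⟨q, hq⟩ : ∃ q : ℤ, ((bb.val : ℕ) : ℤ) = b + 2 ^ (k' + 2) * q := by
      refine ⟨-(b / ((2 ^ (k' + 2) : ℕ) : ℤ)), ?_⟩
      have h := Int.emod_add_ediv_mul b ((2 ^ (k' + 2) : ℕ) : ℤ)
      rw [hval]
      push_cast at h ⊢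
      linear_combination h
    have hodd : ¬ 2 ∣ bb.val := by
      rintro ⟨c, hc⟩
      obtain ⟨t, ht⟩ := hb
      have h1 : ((bb.val : ℕ) : ℤ) = 2 * (c : ℤ) := by rw [hc]; push_cast; ring
      have h2 : (2 : ℤ) ^ (k' + 2) * q = 2 * (2 ^ (k' + 1) * q) := by ring
      rw [h1, ht, h2] at hq
      generalize (2 : ℤ) ^ (k' + 1) * q = M at hq
      omega
    have e1 : ratPlusSymbol f (((bb.val : ℕ) : ℚ) / (2 : ℚ) ^ (k' + 2)) =
        ratPlusSymbol f ((b : ℚ) / (2 : ℚ) ^ (k' + 2)) := by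
      have : ((bb.val : ℕ) : ℚ) = ((b + 2 ^ (k' + 2) * q : ℤ) : ℚ) := by exact_mod_cast hq
      rw [this, hper]
    have e2 : ratPlusSymbol f (((bb.val : ℕ) : ℚ) / (2 : ℚ) ^ (k' + 1)) =
        ratPlusSymbol f ((b : ℚ) / (2 : ℚ) ^ (k' + 1)) := by
      have : ((bb.val : ℕ) : ℚ) = ((b + 2 ^ (k' + 1) * (2 * q) : ℤ) : ℚ) := by
        have : ((bb.val : ℕ) : ℤ) = b + 2 ^ (k' + 1) * (2 * q) := by rw [hq]; ring
        exact_mod_cast this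
      rw [this, hper]
    -- unfold the measure
    have hμ : 2 * msdMeasure f α (k' + 2) bb =
        α⁻¹ ^ (k' + 3) * (α * (D (k' + 2) b + S₀) - (D (k' + 1) b + S₀)) := by
      have hu : msdMeasure f α (k' + 2) bb =
          α⁻¹ ^ (k' + 2) * ((ratPlusSymbol f (((bb.val : ℕ) : ℚ) / (2 : ℚ) ^ (k' + 2)) : ℚ) : ℚ_[2]) -
            α⁻¹ ^ (k' + 3) * ((ratPlusSymbol f (((bb.val : ℕ) : ℚ) / (2 : ℚ) ^ (k' + 1)) : ℚ) :
              ℚ_[2]) := by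
        simp only [msdMeasure, Nat.cast_ofNat]
      rw [hu, e1, e2, mul_sub, ← mul_assoc, ← mul_assoc, mul_comm (2 : ℚ_[2]), mul_comm (2 : ℚ_[2]),
        mul_assoc, mul_assoc, hsym, hsym]
      have hαα : α⁻¹ ^ (k' + 3) * α = α⁻¹ ^ (k' + 2) := by
        rw [pow_succ, mul_assoc, inv_mul_cancel₀ hα0, mul_one]
      rw [← hαα]
      ring
    have hn := hH k' bb hodd
    rw [hμ, norm_mul, hαi, one_mul] at hn
    -- `α(D₂ + S₀) − (D₁ + S₀) = (D₂ − D₁) + (α − 1)·D₂ + (α − 1)·S₀`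
    have hsplit : D (k' + 2) b - D (k' + 1) b =
        (α * (D (k' + 2) b + S₀) - (D (k' + 1) b + S₀)) +
          -((α - 1) * D (k' + 2) b + (α - 1) * S₀) := by ring
    have hA : ‖(α - 1) * D (k' + 2) b‖ ≤ 2⁻¹ := by
      rw [norm_mul]
      calc ‖α - 1‖ * ‖D (k' + 2) b‖ ≤ 2⁻¹ * 1 :=
            mul_le_mul hα1 (hD1 _ _) (norm_nonneg _) (by norm_num)
        _ = 2⁻¹ := mul_one _
    rw [hsplit]
    refine (Padic.nonarchimedean _ _).trans (max_le hn ?_)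
    rw [norm_neg]
    exact (Padic.nonarchimedean _ _).trans (max_le hA hε)
  -- induction on the level: every `D k b` is even
  have hall : ∀ (k : ℕ) (b : ℤ), ‖D k b‖ ≤ 2⁻¹ := by
    intro k
    induction k with
    | zero =>
      intro b
      have e : D 0 b = 0 := by
        simp only [hD_def]
        have : ((b : ℚ) / (2 : ℚ) ^ 0) = 0 + (b : ℤ) := by simp
        rw [this, ratPlusSymbol_add_intCast_eq, sub_self, mul_zero]
        push_cast
        rfl
      rw [e, norm_zero]; norm_num
    | succ k ih =>
      intro b
      rcases Int.even_or_odd b with ⟨c, rfl⟩ | hodd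
      · -- even numerator: reduce the level
        have e : D (k + 1) (c + c) = D k c := by
          simp only [hD_def]
          congr 3
          push_cast
          ring
        rw [e]
        exact ih c
      · cases k with
        | zero =>
          -- level one: `D(1,b) = (a₂ − 3)·S₀`, `a₂ − 3` even
          have e : D 1 b = (((a₂ - 3 : ℤ)) : ℚ_[2]) * S₀ := by
            simp only [hD_def, hS₀_def]
            rw [two_mul_ratPlusSymbol_sub_one_eq hf hQ h2N ha₂ hodd]
            push_cast
            ring
          rw [e, norm_mul]
          have h3 : (2 : ℤ) ∣ a₂ - 3 := by omega
          calc ‖((a₂ - 3 : ℤ) : ℚ_[2])‖ * ‖S₀‖ ≤ 2⁻¹ * 1 :=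
                mul_le_mul (norm_intCast_le_half_of_two_dvd h3) hS₀ (norm_nonneg _) (by norm_num)
            _ = 2⁻¹ := mul_one _
        | succ k' =>
          -- level `k' + 2 ≥ 2`: the step + the induction hypothesis at level `k' + 1`
          have hs := hstep k' b hodd
          have hi := ih b
          calc ‖D (k' + 1 + 1) b‖ = ‖(D (k' + 2) b - D (k' + 1) b) + D (k' + 1) b‖ := by
                congr 1; ring_nf
            _ ≤ max ‖D (k' + 2) b - D (k' + 1) b‖ ‖D (k' + 1) b‖ := Padic.nonarchimedean _ _
            _ ≤ 2⁻¹ := max_le hs hi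
  -- contradiction with the half-integral winding class
  obtain ⟨k, b, hkb⟩ := hw
  have h := hall k b
  simp only [hD_def] at h
  have : (1 : ℝ) ≤ 2⁻¹ := hkb.trans h
  norm_num at this

end Collapse

end Summit.BirchSwinnertonDyer.BirchSwinnertonDyer.Theorems.AnalyticMuTwo

end
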